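import Summits.QuantumFields.BalabanUV.Beta.GAN24.FineReadoutCauchyFold

/-!
# `BalabanUV.Beta.GAN24.FineReadoutCauchyGlue` — «(N1-Cauchy)» PART S1: the difference symbol = MATCHED LABELS termwise + the NEW-LABEL cell tail

**G-an2-4 FORMALISATION SWARM, b2b-balaban-gan24-formalise-leaf-17 (gen 11) — PART S1 (holder's glue) of the located leaf «(N1-Cauchy)»**
(division `HOME/b2b-balaban-gan24-formalise-leaf-17/g11/N1-CAUCHY-DIVISION.md` v2.1; HOLDER RULING CLAIMS 2026-08-20T05:15:36Z: the parts
are glued in road P1's L11 matched-label currency `AliasReindex.lift` / `newLabels` — PART A (leaf-16) bounds the matched terms, PART K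
(leaf-01, `GAN24/FineReadoutCauchyTail`, LANDED) bounds the new-label cell tail in exactly the shape produced here, the real-zone assembly is
leaf-13's `GAN24/FineReadoutCauchyReal`).  NOT IN PRINT; OUR PROOF ATTEMPT.  [folklore] finite Fourier bookkeeping, no analysis.

HONEST FRAMING (verbatim): «discharging `BetaPertH` makes Bałaban's UV stability UNCONDITIONAL — a real constructive-QFT result;
it is NOT the continuum limit and NOT the Clay problem.»
HONEST DEPENDENCY (verbatim): «continuum YM on T⁴ ⇐ BetaPertH ∧ nine spine estimates (0/9 proved); BetaPertH ⇐ (D1) ∧ (D4) ∧ CAP+tail;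
G-an2-4 gates asym, D1 and NE2/3/4.»

## What is here
With the CANONICAL per-alias amplitudes `ampA p v m κ` of the inverse-fibre column `v = fibInv N · (Q,l) p` (`FibreDFTDictionary.boxData_inl_eq_sum`,
valid at EVERY momentum, no determinant/Laplacian hypothesis):
* §1 `pw_kFine_eq_pw_kSym`: at integer sites the plane wave of `kFine p m` is that of the centred momentum `kSym N p m`;
  **`pw_kFine_lift_zsmul`**: the cell phase of a LIFTED label folds — `pw (kFine_{N′} p (lift N′ m)) (Lc•ζ) = pw (kSym N p m) ζ` (`N′ = N·Lc`).
* §2 **`diffSym_eq_matched_add_tail (hN : N′ = N·Lc)`**: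
  `diffSym N N′ Lc κ l z p = Σ_{m : (ℤ/N)^{d+1}} ((Lc^{d+1})⁻¹·N′^{d+2}·boxW Lc (kFine p (lift N′ m))·ampA p col′ (lift N′ m) κ − N^{d+2}·ampA p col m κ)·pw (kSym N p m) (repZ (proj N z))`
  `  + (Lc^{d+1})⁻¹·N′^{d+2}·Σ_{r ∈ box Lc} Σ_{m′ ∈ newLabels N N′} ampA p col′ m′ κ·pw (kFine p m′) (repZ (proj N′ (Lc•z + toSite r)))`
  — the second line is LITERALLY the expression bounded by `FineReadoutCauchyTail.norm_cellMean_newLabels_le`; the first is PART A's object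
  (`boxW = Π_i gs`, `FineReadoutCauchyFold.boxW_eq_prod`).
Discharges NOTHING of `(hS, hSall)`.  0 sorry, axioms {propext, Classical.choice, Quot.sound}.
-/

noncomputable section

open Complex Finset
open scoped Real BigOperators
open Literature.MathematicalPhysics.QuantumFieldTheory
open Literature.MathematicalPhysics.QuantumFieldTheory.Balaban1983to89
open Literature.MathematicalPhysics.QuantumFieldTheory.Balaban1983to89.Beta
open Literature.Probability.LatticeModels (Site TorusSite Torus.proj)
open LatticeForm (repZ quo)
open BlochFibreMatrix (Idx)
open AffineAveraging (box toSite)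
open Summit.QuantumFields.BalabanUV.Beta.GAN24.CombesThomasFibre (fibInv)
open Summit.QuantumFields.BalabanUV.Beta.GAN24.FibreSymbols (pw pw_add)
open Summit.QuantumFields.BalabanUV.Beta.GAN24.FibreDFT (kFine)
open Summit.QuantumFields.BalabanUV.Beta.GAN24.FibreDFTDictionary (ampA boxData_inl_eq_sum)
open Summit.QuantumFields.BalabanUV.Beta.GAN24.AliasReindex (lift newLabels srep shiftZ kSym kSym_apply srep_lift repZ_eq_srep_add
  sum_eq_sum_lift_add_sum_newLabels)
open Summit.QuantumFields.BalabanUV.Beta.GAN24.FineReadoutCauchyFrame (diffSym)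
open Summit.QuantumFields.BalabanUV.Beta.GAN24.FineReadoutCauchyFold (boxW pw_zsmul pw_add_two_pi_int repZ_proj_cell)

namespace Summit.QuantumFields.BalabanUV.Beta.GAN24.FineReadoutCauchyGlue

variable {d : ℕ}

/-! ## §1 Plane waves of centred momenta; the cell phase of a lifted label -/

/-- [folklore] `kFine p m = kSym N p m + 2π·shiftZ m` coordinatewise. -/
theorem kFine_eq_kSym_add {N : ℕ} [NeZero N] (p : Fin (d + 1) → ℂ) (m : TorusSite (d + 1) N) :
    kFine p m = fun i => kSym N p m i + 2 * π * ((shiftZ m i : ℤ) : ℂ) := by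
  funext i
  have hN : (N : ℂ) ≠ 0 := by exact_mod_cast NeZero.ne N
  rw [kSym_apply, show kFine p m i = (p i + 2 * π * (repZ m i : ℂ)) / (N : ℂ) from rfl, repZ_eq_srep_add m i]
  push_cast
  field_simp
  ring

/-- [folklore] At integer sites the plane wave of `kFine p m` equals that of the centred momentum `kSym N p m`. -/
theorem pw_kFine_eq_pw_kSym {N : ℕ} [NeZero N] (p : Fin (d + 1) → ℂ) (m : TorusSite (d + 1) N) (x : Site (d + 1)) :
    pw (kFine p m) x = pw (kSym N p m) x := by
  rw [kFine_eq_kSym_add, pw_add_two_pi_int]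

/-- [folklore] `N ≤ N·Lc` for `Lc ≥ 1`. -/
theorem le_of_eq_mul {N N' Lc : ℕ} [NeZero Lc] (hN : N' = N * Lc) : N ≤ N' := by
  rw [hN]; exact Nat.le_mul_of_pos_right _ (Nat.pos_of_ne_zero (NeZero.ne Lc))

/-- [folklore] **THE CELL PHASE OF A LIFTED LABEL FOLDS**: `pw (kFine_{N′} p (lift N′ m)) (Lc•ζ) = pw (kSym N p m) ζ` for `N′ = N·Lc` —
`Lc·(p + 2π·repZ (lift N′ m))/N′ = (p + 2π·srep m)/N + 2π·Lc·shiftZ`. -/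
theorem pw_kFine_lift_zsmul {N N' Lc : ℕ} [NeZero N] [NeZero N'] [NeZero Lc] (hN : N' = N * Lc) (p : Fin (d + 1) → ℂ)
    (m : TorusSite (d + 1) N) (ζ : Site (d + 1)) :
    pw (kFine p (lift N' m)) ((Lc : ℤ) • ζ) = pw (kSym N p m) ζ := by
  rw [pw_zsmul]
  have hNc : (N : ℂ) ≠ 0 := by exact_mod_cast NeZero.ne N
  have hLc : (Lc : ℂ) ≠ 0 := by exact_mod_cast NeZero.ne Lc
  have h : (fun μ => ((Lc : ℤ) : ℂ) * kFine p (lift N' m) μ) =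
      fun μ => kSym N p m μ + 2 * π * (((Lc : ℤ) * shiftZ (lift N' m) μ : ℤ) : ℂ) := by
    funext μ
    rw [kSym_apply, show kFine p (lift N' m) μ = (p μ + 2 * π * (repZ (lift N' m) μ : ℂ)) / (N' : ℂ) from rfl,
      repZ_eq_srep_add (lift N' m) μ, srep_lift (le_of_eq_mul hN) m, hN]
    push_cast
    field_simp
    ring
  rw [h, pw_add_two_pi_int]

/-! ## §2 THE GLUE IDENTITY -/

/-- [folklore] **THE DIFFERENCE SYMBOL = MATCHED LABELS TERMWISE + THE NEW-LABEL CELL TAIL** (`N′ = N·Lc`; every momentum `p`):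
with `col_N i := fibInv N i (Q,l) p` and the canonical amplitudes `ampA`,
`diffSym N N′ Lc κ l z p = Σ_m ((Lc^{d+1})⁻¹·N′^{d+2}·boxW Lc (k′_{lift m})·ampA p col′ (lift N′ m) κ − N^{d+2}·ampA p col m κ)·pw (kSym N p m) (repZ (proj N z))`
`  + (Lc^{d+1})⁻¹·N′^{d+2}·Σ_{r ∈ box Lc} Σ_{m′ ∈ newLabels N N′} ampA p col′ m′ κ·pw (kFine p m′) (repZ (proj N′ (Lc•z + toSite r)))`. -/
theorem diffSym_eq_matched_add_tail {N N' Lc : ℕ} [NeZero N] [NeZero N'] [NeZero Lc] (hN : N' = N * Lc)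
    (p : Fin (d + 1) → ℂ) (κ l : Fin (d + 1)) (z : Site (d + 1)) :
    diffSym N N' Lc κ l z p =
      (∑ m : TorusSite (d + 1) N,
        (((Lc : ℂ) ^ (d + 1))⁻¹ * ((N' : ℂ) ^ (d + 2)) *
            (boxW Lc (kFine p (lift N' m)) * ampA p (fun i => fibInv N' i (Sum.inr (Sum.inr l)) p) (lift N' m) κ) -
          ((N : ℂ) ^ (d + 2)) * ampA p (fun i => fibInv N i (Sum.inr (Sum.inr l)) p) m κ) *
          pw (kSym N p m) (repZ (Torus.proj N z))) +
      (((Lc : ℂ) ^ (d + 1))⁻¹ * ((N' : ℂ) ^ (d + 2)) *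
        ∑ r ∈ box (d + 1) Lc, ∑ m' ∈ (newLabels N N' : Finset (TorusSite (d + 1) N')),
          ampA p (fun i => fibInv N' i (Sum.inr (Sum.inr l)) p) m' κ *
            pw (kFine p m') (repZ (Torus.proj N' ((Lc : ℤ) • z + toSite r)))) := by
  have hNN' : N ≤ N' := le_of_eq_mul hN
  set col' : Idx (d + 1) N' → ℂ := fun i => fibInv N' i (Sum.inr (Sum.inr l)) p with hcol'
  set col : Idx (d + 1) N → ℂ := fun i => fibInv N i (Sum.inr (Sum.inr l)) p with hcol
  set ζ : Site (d + 1) := repZ (Torus.proj N z) with hζ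
  set c' : ℂ := (((Lc : ℂ) ^ (d + 1))⁻¹ * ((N' : ℂ) ^ (d + 2))) with hc'
  -- expand every cell term and split its alias sum into lifted labels + new labels
  have hcell : ∀ r ∈ box (d + 1) Lc, fibInv N' (Sum.inl (κ, Torus.proj N' ((Lc : ℤ) • z + toSite r))) (Sum.inr (Sum.inr l)) p =
      (∑ m : TorusSite (d + 1) N, ampA p col' (lift N' m) κ * pw (kFine p (lift N' m)) (repZ (Torus.proj N' ((Lc : ℤ) • z + toSite r)))) +
        ∑ m' ∈ (newLabels N N' : Finset (TorusSite (d + 1) N')),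
          ampA p col' m' κ * pw (kFine p m') (repZ (Torus.proj N' ((Lc : ℤ) • z + toSite r))) := by
    intro r _
    have h := boxData_inl_eq_sum p col' κ (Torus.proj N' ((Lc : ℤ) • z + toSite r))
    rw [hcol'] at h
    simp only at h
    rw [h]
    exact sum_eq_sum_lift_add_sum_newLabels hNN' _
  -- the lifted part: swap the sums and fold the cell phase
  have hlift : ∑ r ∈ box (d + 1) Lc, ∑ m : TorusSite (d + 1) N,
      ampA p col' (lift N' m) κ * pw (kFine p (lift N' m)) (repZ (Torus.proj N' ((Lc : ℤ) • z + toSite r))) =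
      ∑ m : TorusSite (d + 1) N, boxW Lc (kFine p (lift N' m)) * ampA p col' (lift N' m) κ * pw (kSym N p m) ζ := by
    rw [Finset.sum_comm]
    refine Finset.sum_congr rfl fun m _ => ?_
    have h3 : ∀ r ∈ box (d + 1) Lc,
        ampA p col' (lift N' m) κ * pw (kFine p (lift N' m)) (repZ (Torus.proj N' ((Lc : ℤ) • z + toSite r))) =
        ampA p col' (lift N' m) κ * pw (kSym N p m) ζ * pw (kFine p (lift N' m)) (toSite r) := by
      intro r hr
      rw [repZ_proj_cell hN z hr, pw_add, pw_kFine_lift_zsmul hN]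
      ring
    rw [Finset.sum_congr rfl h3, ← Finset.mul_sum]
    unfold boxW
    ring
  -- the level-`N` term
  have hN0 : fibInv N (Sum.inl (κ, Torus.proj N z)) (Sum.inr (Sum.inr l)) p = ∑ m : TorusSite (d + 1) N, ampA p col m κ * pw (kSym N p m) ζ := by
    have h := boxData_inl_eq_sum p col κ (Torus.proj N z)
    rw [hcol] at h
    simp only at h
    rw [h]
    exact Finset.sum_congr rfl fun m _ => by rw [pw_kFine_eq_pw_kSym]
  have e1 : c' * ∑ m : TorusSite (d + 1) N, boxW Lc (kFine p (lift N' m)) * ampA p col' (lift N' m) κ * pw (kSym N p m) ζ =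
      ∑ m : TorusSite (d + 1) N, c' * (boxW Lc (kFine p (lift N' m)) * ampA p col' (lift N' m) κ * pw (kSym N p m) ζ) := by
    rw [Finset.mul_sum]
  have e2 : ((N : ℂ) ^ (d + 2)) * ∑ m : TorusSite (d + 1) N, ampA p col m κ * pw (kSym N p m) ζ =
      ∑ m : TorusSite (d + 1) N, ((N : ℂ) ^ (d + 2)) * (ampA p col m κ * pw (kSym N p m) ζ) := by
    rw [Finset.mul_sum]
  unfold diffSym
  rw [Finset.sum_congr rfl hcell, Finset.sum_add_distrib, hlift, hN0, mul_add,
    show ∀ X T Y : ℂ, X + T - Y = (X - Y) + T from fun X T Y => by ring, e1, e2, ← Finset.sum_sub_distrib]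
  congr 1
  exact Finset.sum_congr rfl fun m _ => by ring

end Summit.QuantumFields.BalabanUV.Beta.GAN24.FineReadoutCauchyGlue

end
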